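import Summits.QuantumFields.BalabanUV.Beta.BorderWardSiteLawFluct

/-!
# `BalabanUV.Beta.BorderGaugeLegContactTwo` — binder row D1, (COV-m) letters at ORDER 2 for the ROOTED composite tower: **THE FLUCTUATION-LEG PURE-GAUGE LAW OF
# an1's ROOTED SECOND-ORDER BORDER TABLES — the real kernel `vh2KerAt ρ`, the packed family `vh₂SAt ρ`, and the `(κ,u) ↔ (κ′,u′)`-SYMMETRISED PACKED PAIR**
# (kernel ∕ `MKer` level, every site, ANY root `ρ`; the rooted non-symmetrised twin of my g23 (P) `SymBorderGaugeLegContactTwo`) (β sub-cell; D1 formalisation swarm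
# LEAF PROVER 02, road «FP» ROUTE T, (COV-m) order 2 — the letter behind the composite torus call's `c2 ∕ d2` at every depth, whose order-1 rows C1∕C2 use the
# ROOTED presentation `vhSAt (toSite r)`)

HONEST FRAMING (cell charter, verbatim): «discharging BetaPertH makes Balaban's UV stability UNCONDITIONAL — a real
constructive-QFT result; it is NOT the continuum limit and NOT the Clay problem.»
HONEST DEPENDENCY: continuum YM on T⁴ ⇐ BetaPertH ∧ nine spine estimates (0/9 proved); BetaPertH ⇐ (D1) ∧ (D4) ∧ CAP+tail;
G-an2-4 gates asym, D1 and NE2/3/4.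
DERIVED cell leaf ([folklore] re-indexing of a kernel identity through node 7a's packer), BY NAME over G4-B′ `BorderWardSiteLawFluct.vh2Tab_siteWard₀` (my g23), an1's
rooted kernels (`vhKerAt ∕ linKerAt ∕ hessKerAt`, `hessKerAt_swap`, `vh2KerAt`, `vh₂SAt`), node 7a (`packVH`, `eq_smul_blk_of_off_eq_zero`).  No statement of Bałaban's
papers, no `[cite:]`, no `def`, no `Prop` fact; no VALUE of any table asserted; nothing of the dictionary's identification of `vh₂SAt` with Bałaban's jet is used or
claimed.  Discharges NO binder; 0∕4.  NOT D1, NOT `BetaPertH`, NOT continuum, NOT Clay.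

WHAT (`m = vhKerAt`, `q = linKerAt`, `h = hessKerAt` — an1's ROOTED mean kernels (fluctuation bond FIRST, background bond second); `r₊ = L·y + ρ + L·e_μ`; bonds
`g = (κ,u)`, `h′ = (κ′,u′)`, `g₊ = u + e_κ`):
* §1 **`vh2KerAt_div_fluct`** (`L ≠ 0`): `Σ_κ (s((κ, z − e_κ); g, h′) − s((κ, z); g, h′)) = 2·[z = h′₊]·m(h′, g) − [g = h′]·[z = g₊]·q(g) + [z = r₊]·(2·h(g, h′) + q(g)·q(h′))`.
* §2 **`gaugeLeg_vh₂SAt_inr_inl`** (`1 ≤ L`; multiplier leg packed at `x`, fluctuation leg `(α, z)`, block `y = blk L x`): the same on the `(inr μ, inl α)` block of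
  `vh₂SAt ρ L κ u κ′ u′`, guarded by `[off L x = 0]`, with `r₊ = x + ρ + L·e_μ`.
* §3 **`gaugeLeg_vh₂SAt_symm_inr_inl`**: for the SYMMETRISED PACKED PAIR `½·(vh₂SAt ρ L κ u κ′ u′ + vh₂SAt ρ L κ′ u′ κ u)`,
  `Σ_α (… (z − e_α) (inr μ) (inl α) − … z (inr μ) (inl α))
   = [off L x = 0]·([z = h′₊]·m(h′, g) + [z = g₊]·m(g, h′) − [g = h′]·[z = g₊]·q(g) + [z = x + ρ + L·e_μ]·q(g)·q(h′))`
  — BOTH family bonds' TIP contacts, each carrying the first-order kernel WITH THE OTHER BOND IN THE FLUCTUATION SLOT; the diagonal `g = h′` carrying `−q(g)` at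
  `g₊`; the ROOT contact at the far end of the coarse bond carrying ONLY the product `q(g)·q(h′)` — the `h` terms of §1∕§2 CANCEL under the symmetrisation
  (`hessKerAt_swap`).  (P) §3's shape for the centred row table `symVh₂SAn1` up to its overall minus; here ANY root and no minus.
READING toward the composite tower (bookkeeping; the torus face is the sequel `FP/PeriodisedBorderWardContactTwo`): with `m` read as C1's rooted member
`perF (dper (vhSAt ρ β))` and `q` as `c_ℓ·Qstep` (g17's bridge `tsum_linSymAt_translate_eq`), §3 is the per-site identity whose torus face is the one-step law
`stepIns₂ w · D = 2•stepIns₁ w · Tip(w) − c_ℓ•Qstep·Tip(w⊙w) + c_ℓ²•Far((Qstep w)⊙(Qstep w))` of the composite tower's order 2.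
Provenance: D1 formalisation swarm LEAF PROVER 02, unit b2b-balaban-beta-d1-formalise-leaf-02 gen 25, 2026-08-23; no existing file touched.
-/

namespace Summit.QuantumFields.BalabanUV.Beta.BorderGaugeLegContactTwo

open Finset
open scoped BigOperators Nat
open Literature.MathematicalPhysics.QuantumFieldTheory.Balaban1983to89
open Literature.MathematicalPhysics.QuantumFieldTheory.Balaban1983to89.Beta
open AffineAveraging (Form1 Site unitVec)
open AveragingContours (blk off)
open AveragingHessianKernels (Bond packVH packVH_inr_inl packVH_inl_inr eq_smul_blk_of_off_eq_zero)
open AveragingHessianKernelsRooted (vhKerAt linKerAt hessKerAt vhCountAt hessCountAt linCountAt hessKerAt_swap)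
open AveragingMixedJetTables (vh2Tab vh2KerAt vh₂SAt)
open Summit.QuantumFields.BalabanUV.Beta.BorderWardSiteLawFluct (vh2Tab_siteWard₀)

variable {d : ℕ}

/-! ## §1 Kernel level, real currency: the fluctuation-slot law of `vh2KerAt` in an1's rooted kernels -/

section Kernel

open Classical in
/-- [folklore] **THE FLUCTUATION-SLOT LAW OF THE REAL ROOTED SECOND-ORDER BORDER KERNEL** `s = vh2KerAt ρ` in the letters of an1's rooted kernels
`m = vhKerAt` (`= VHcount∕(2L^{2d})`), `q = linKerAt` (`= LINcount∕L^d`), `h = hessKerAt` (`= HESScount∕(2L^d)`):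
`Σ_κ (s((κ, z − e_κ); g, h′) − s((κ, z); g, h′)) = 2·[z = h′₊]·m(h′, g) − [g = h′]·[z = g₊]·q(g) + [z = r₊]·(2·h(g, h′) + q(g)·q(h′))`. -/
theorem vh2KerAt_div_fluct {L : ℕ} (hL : L ≠ 0) (ρ : Fin d → ℤ) (μ : Fin d) (y z : Fin d → ℤ) (g h : Bond d) :
    ∑ κ : Fin d, (vh2KerAt ρ L μ y (κ, z - unitVec κ) g h - vh2KerAt ρ L μ y (κ, z) g h)
      = 2 * (if h.2 + unitVec h.1 = z then (1 : ℝ) else 0) * vhKerAt ρ L μ y h g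
        - (if g = h ∧ g.2 + unitVec g.1 = z then (1 : ℝ) else 0) * linKerAt ρ L μ y g
        + (if (L : ℤ) • y + ρ + (L : ℤ) • unitVec μ = z then (1 : ℝ) else 0)
            * (2 * hessKerAt ρ L μ y g h + linKerAt ρ L μ y g * linKerAt ρ L μ y h) := by
  have hLq : (L : ℚ) ≠ 0 := Nat.cast_ne_zero.2 hL
  have hLr : (L : ℝ) ≠ 0 := Nat.cast_ne_zero.2 hL
  have key := congrArg (fun q : ℚ => (q : ℝ)) (vh2Tab_siteWard₀ hLq ρ μ y z g h)
  simp only [Rat.cast_sum, Rat.cast_sub, Rat.cast_add, Rat.cast_mul, Rat.cast_inv, Rat.cast_pow, Rat.cast_natCast, Rat.cast_intCast,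
    apply_ite (Rat.cast : ℚ → ℝ), Rat.cast_one, Rat.cast_zero] at key
  have hs : ∀ κ : Fin d, vh2KerAt ρ L μ y (κ, z - unitVec κ) g h - vh2KerAt ρ L μ y (κ, z) g h
      = ((vh2Tab ρ L μ y (κ, z - unitVec κ) g h : ℚ) : ℝ) - ((vh2Tab ρ L μ y (κ, z) g h : ℚ) : ℝ) := fun κ => rfl
  simp only [hs, key, vhKerAt, linKerAt, hessKerAt]
  field_simp
  ring

end Kernel

/-! ## §2 The packed table `vh₂SAt ρ`: the fluctuation-leg law on the `(inr μ, inl α)` block (fluctuation leg in the SECOND `MKer` slot) -/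

section Packed

open Classical in
/-- [folklore] **THE FLUCTUATION-LEG LAW OF an1's PACKED ROOTED SECOND-ORDER BORDER TABLE, `(inr μ, inl α)` BLOCK** (multiplier leg packed at `x`,
fluctuation leg `(α, z)`; family bonds `g = (κ, u)` — the closed-over FIRST background — and `h′ = (κ′, u′)`):
`Σ_α (S₂ κ u κ′ u′ x (z − e_α) (inr μ) (inl α) − S₂ κ u κ′ u′ x z (inr μ) (inl α))
= [off L x = 0] · (2·[z = u′ + e_{κ′}]·m_{μ,blk x}((κ′,u′), (κ,u)) − [(κ,u) = (κ′,u′)]·[z = u + e_κ]·q(κ,u) + [z = x + ρ + L·e_μ]·(2·h((κ,u),(κ′,u′)) + q(κ,u)·q(κ′,u′)))`. -/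
theorem gaugeLeg_vh₂SAt_inr_inl {L : ℕ} (hL : 1 ≤ L) (ρ : Fin (d + 1) → ℤ) (κ : Fin (d + 1)) (u : Fin (d + 1) → ℤ) (κ' : Fin (d + 1))
    (u' x z : Fin (d + 1) → ℤ) (μ : Fin (d + 1)) :
    (∑ α, (vh₂SAt ρ L κ u κ' u' x (z - unitVec α) (Sum.inr μ) (Sum.inl α) - vh₂SAt ρ L κ u κ' u' x z (Sum.inr μ) (Sum.inl α)))
      = if off L x = 0 then
          2 * (if u' + unitVec κ' = z then (1 : ℝ) else 0) * vhKerAt ρ L μ (blk L x) (κ', u') (κ, u)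
          - (if (κ, u) = (κ', u') ∧ u + unitVec κ = z then (1 : ℝ) else 0) * linKerAt ρ L μ (blk L x) (κ, u)
          + (if x + ρ + (L : ℤ) • unitVec μ = z then (1 : ℝ) else 0)
              * (2 * hessKerAt ρ L μ (blk L x) (κ, u) (κ', u') + linKerAt ρ L μ (blk L x) (κ, u) * linKerAt ρ L μ (blk L x) (κ', u'))
        else 0 := by
  simp only [vh₂SAt, packVH_inr_inl]
  by_cases hx : off L x = 0
  · simp only [hx, if_true]
    rw [vh2KerAt_div_fluct (by omega), ← eq_smul_blk_of_off_eq_zero hL hx]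
  · simp [hx]

end Packed

/-! ## §3 The symmetrised packed pair: the hess terms CANCEL, the mirrored tip appears -/

section Symm

open Classical in
/-- [folklore] **THE FLUCTUATION-LEG LAW OF THE SYMMETRISED PACKED PAIR `½·(vh₂SAt ρ L κ u κ′ u′ + vh₂SAt ρ L κ′ u′ κ u)`, `(inr μ, inl α)` BLOCK**
(any root `ρ`; multiplier leg at `x`, fluctuation leg `(α, z)`):
`Σ_α (½(S₂ κ u κ′ u′ + S₂ κ′ u′ κ u) x (z − e_α) (inr μ) (inl α) − ½(…) x z (inr μ) (inl α)) = [off L x = 0] · ([z = u′ + e_{κ′}]·m((κ′,u′),(κ,u))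
+ [z = u + e_κ]·m((κ,u),(κ′,u′)) − [(κ,u) = (κ′,u′)]·[z = u + e_κ]·q(κ,u) + [z = x + ρ + L·e_μ]·q(κ,u)·q(κ′,u′))` — the two family bonds' TIP contacts carry the
FIRST-order kernel with the OTHER bond in the fluctuation slot, the diagonal carries the linear kernel, the ROOT contact at the far end of the coarse bond carries the
PRODUCT of the two linear kernels, and the `h` terms of §2 CANCEL (`hessKerAt_swap`). -/
theorem gaugeLeg_vh₂SAt_symm_inr_inl {L : ℕ} (hL : 1 ≤ L) (ρ : Fin (d + 1) → ℤ) (κ : Fin (d + 1)) (u : Fin (d + 1) → ℤ) (κ' : Fin (d + 1))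
    (u' x z : Fin (d + 1) → ℤ) (μ : Fin (d + 1)) :
    (∑ α, ((1 / 2 : ℝ) * (vh₂SAt ρ L κ u κ' u' x (z - unitVec α) (Sum.inr μ) (Sum.inl α) + vh₂SAt ρ L κ' u' κ u x (z - unitVec α) (Sum.inr μ) (Sum.inl α))
        - (1 / 2 : ℝ) * (vh₂SAt ρ L κ u κ' u' x z (Sum.inr μ) (Sum.inl α) + vh₂SAt ρ L κ' u' κ u x z (Sum.inr μ) (Sum.inl α))))
      = if off L x = 0 then
          (if u' + unitVec κ' = z then (1 : ℝ) else 0) * vhKerAt ρ L μ (blk L x) (κ', u') (κ, u)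
          + (if u + unitVec κ = z then (1 : ℝ) else 0) * vhKerAt ρ L μ (blk L x) (κ, u) (κ', u')
          - (if (κ, u) = (κ', u') ∧ u + unitVec κ = z then (1 : ℝ) else 0) * linKerAt ρ L μ (blk L x) (κ, u)
          + (if x + ρ + (L : ℤ) • unitVec μ = z then (1 : ℝ) else 0)
              * (linKerAt ρ L μ (blk L x) (κ, u) * linKerAt ρ L μ (blk L x) (κ', u'))
        else 0 := by
  have hsum : (∑ α, ((1 / 2 : ℝ) * (vh₂SAt ρ L κ u κ' u' x (z - unitVec α) (Sum.inr μ) (Sum.inl α) + vh₂SAt ρ L κ' u' κ u x (z - unitVec α) (Sum.inr μ) (Sum.inl α))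
        - (1 / 2 : ℝ) * (vh₂SAt ρ L κ u κ' u' x z (Sum.inr μ) (Sum.inl α) + vh₂SAt ρ L κ' u' κ u x z (Sum.inr μ) (Sum.inl α))))
      = (1 / 2 : ℝ) * ((∑ α, (vh₂SAt ρ L κ u κ' u' x (z - unitVec α) (Sum.inr μ) (Sum.inl α) - vh₂SAt ρ L κ u κ' u' x z (Sum.inr μ) (Sum.inl α)))
          + ∑ α, (vh₂SAt ρ L κ' u' κ u x (z - unitVec α) (Sum.inr μ) (Sum.inl α) - vh₂SAt ρ L κ' u' κ u x z (Sum.inr μ) (Sum.inl α))) := by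
    rw [← Finset.sum_add_distrib, Finset.mul_sum]
    exact Finset.sum_congr rfl fun α _ => by ring
  rw [hsum, gaugeLeg_vh₂SAt_inr_inl hL, gaugeLeg_vh₂SAt_inr_inl hL]
  by_cases hx : off L x = 0
  · simp only [hx, if_true]
    rw [hessKerAt_swap ρ L μ (blk L x) (κ, u) (κ', u')]
    by_cases hgh : (κ, u) = (κ', u')
    · have hκ : κ' = κ := (congrArg Prod.fst hgh).symm
      have hu : u' = u := (congrArg Prod.snd hgh).symm
      subst hκ; subst hu
      simp only [true_and]
      split_ifs <;> ring
    · have hhg : ¬ (κ', u') = (κ, u) := fun e => hgh e.symm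
      simp only [hgh, hhg, false_and, if_false]
      split_ifs <;> ring
  · simp [hx]

end Symm

end Summit.QuantumFields.BalabanUV.Beta.BorderGaugeLegContactTwo
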